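import Mathlib.Analysis.SpecialFunctions.Pow.Real
import Mathlib.Analysis.SpecialFunctions.Sqrt
import Literature.Analysis.FunctionSpaces.TorusTrigPoly
import Literature.Analysis.FunctionSpaces.TorusRieszFischerParam
import HarnessLib

/-!
# The normalised Dirichlet kernel `D_r` of a frequency cube on the flat torus `T^d`

Analysis/FunctionSpaces file: the intermittent factor of the intermittent Beltrami flows of
Buckmaster–Vicol (Ann. of Math. 189 (2019), §3.2, (3.7)) and Luo–Titi (Calc. Var. PDE 59 (2020)
= arXiv:1808.07595, §3.2): "Define the Dirichlet kernel
`D_r(x) = (2r+1)^{-3/2} ∑_{ξ ∈ Ω_r} e^{iξ·x}`, `Ω_r = {(j,k,l) : j,k,l ∈ {-r,…,r}}`. It has the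
property that, for `1 < p ≤ ∞`, `‖D_r‖_{L^p} ≲ r^{3/2 - 3/p}`, `‖D_r‖_{L²} = (2π)³`"
(BV19: "normalizing to unit size in `L²` … `‖D_r‖²_{L²} = (2π)³` and `‖D_r‖_{L^p} ≲ r^{3/2-3/p}`
… where the implicit constant depends only on `p`. Note that `-Ω_r = Ω_r`").

On the unit torus `T^d = (ℝ/ℤ)^d` with its probability Haar measure and characters
`e_k(x) = e^{2πik·x}` (the tree's `Torus.trigPoly`) the same object is
`D_r = (2r+1)^{-d/2} ∑_{k ∈ Ω_r} e_k`, `Ω_r = {-r,…,r}^d` (`Torus.freqCube r`), and the printed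
`L²` normalisation reads `∫_{T^d} |D_r|² = 1`.

## Contents

* `Torus.freqCube r` — the frequency cube `{-r,…,r}^d`, symmetric, of cardinality `(2r+1)^d`;
* `Torus.dirichletNorm r = √((2r+1)^d)`, `Torus.dirichletKernel r : T^d → ℂ` — the normalised
  kernel; PROVED: smoothness, Fourier coefficients (`(2r+1)^{-d/2}` on `Ω_r`, `0` off it —
  the frequency localisation `P_{≤√d r} D_r = D_r` in coefficient form), conjugation symmetry
  (real values, `Torus.conj_dirichletKernel`, `Torus.dirichletKernel_im`), the `L²`
  normalisation `∫ ‖D_r‖² = 1` (`Torus.integral_norm_sq_dirichletKernel`, finite Parseval) and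
  the sup bound `‖D_r x‖ ≤ (2r+1)^{d/2}` (`Torus.norm_dirichletKernel_le`, the case `p = ∞` of
  the printed `L^p` bound: `(2r+1)^{d/2} = (2r+1)^{d - d/2}`, here `≤ (3r)^{d/2}` for `r ≥ 1`);
* NAMED FACT `Torus.dirichletKernel_Lp_bound` (not proved here): the printed bound
  `‖D_r‖_{L^p(T³)} ≤ C_p r^{3/2 - 3/p}` for `1 < p < ∞`, `r ≥ 1`, in dimension `3` as printed
  (the proof — tensorisation and the one-dimensional estimate `‖D_n‖_{L^p(T)} ∼ n^{1-1/p}`,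
  BV19 (3.6) after Grafakos — is dimensionless; its discharge is planned in a sibling file).

Not here: the directed, rescaled kernels `η_ξ(t,x) = D_r(λσ(ξ·x + μt, A_ξ·x, (ξ×A_ξ)·x))` and
the intermittent waves `𝕎_ξ = η_ξ B_ξ e^{iλξ·x}` (BV19 (3.8)–(3.12); Luo–Titi (3.3)–(3.5)).

## References

* T. Buckmaster, V. Vicol, Ann. of Math. 189 (2019) = arXiv:1709.10033, §3.2, (3.6)–(3.7).
  [`BuckmasterVicol2019AnnMath`]
* T. Luo, E. S. Titi, Calc. Var. PDE 59 (2020) = arXiv:1808.07595, §3.2. [`LuoTiti2020`]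
* L. Grafakos, *Classical Fourier Analysis*, 3rd ed. (2014), §3.1.3 (the square Dirichlet
  kernel on `𝐓ⁿ`). [`Grafakos2014`]
-/

noncomputable section

open MeasureTheory Set Filter Function UnitAddTorus Complex
open scoped ENNReal BigOperators ComplexConjugate

namespace Literature.Analysis.FunctionSpaces

namespace Torus

variable {d : Type*} [Fintype d] [DecidableEq d]

/-! ## The frequency cube `Ω_r = {-r,…,r}^d` -/

/-- The frequency cube `Ω_r = {k ∈ ℤ^d : |kᵢ| ≤ r for all i}` ("`Ω_r = {(j,k,l) : j,k,l ∈
{-r,⋯,r}}`"). [cite: LuoTiti2020, §3.2] -/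
def freqCube (r : ℕ) : Finset (d → ℤ) :=
  Fintype.piFinset fun _ : d => Finset.Icc (-(r : ℤ)) r

/-- Membership in the frequency cube. [folklore] -/
theorem mem_freqCube {r : ℕ} {k : d → ℤ} : k ∈ freqCube r ↔ ∀ i, -(r : ℤ) ≤ k i ∧ k i ≤ r := by
  simp [freqCube, Fintype.mem_piFinset]

/-- `Ω_r` is symmetric: "`-Ω_r = Ω_r`". [cite: BuckmasterVicol2019AnnMath, §3.2] -/
theorem neg_mem_freqCube {r : ℕ} {k : d → ℤ} (hk : k ∈ freqCube r) : -k ∈ freqCube r := by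
  rw [mem_freqCube] at hk ⊢
  intro i
  have := hk i
  simp only [Pi.neg_apply]
  omega

/-- `0 ∈ Ω_r`. [folklore] -/
theorem zero_mem_freqCube (r : ℕ) : (0 : d → ℤ) ∈ freqCube r := by
  rw [mem_freqCube]; intro i; simp

/-- `#Ω_r = (2r+1)^d`. [cite: BuckmasterVicol2019AnnMath, §3.2] -/
theorem card_freqCube (r : ℕ) : (freqCube (d := d) r).card = (2 * r + 1) ^ Fintype.card d := by
  rw [freqCube, Fintype.card_piFinset, Finset.prod_const, Finset.card_univ]
  congr 1
  rw [Int.card_Icc]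
  omega

/-! ## The normalised kernel -/

/-- The `L²` normalising constant `√((2r+1)^d) = (2r+1)^{d/2}`. [cite: BuckmasterVicol2019AnnMath, §3.2 (3.7)] -/
def dirichletNorm (d : Type*) [Fintype d] (r : ℕ) : ℝ := Real.sqrt ((2 * r + 1 : ℝ) ^ Fintype.card d)

omit [DecidableEq d] in
/-- `(2r+1)^d > 0`. [folklore] -/
theorem pow_card_pos (r : ℕ) : (0 : ℝ) < (2 * r + 1 : ℝ) ^ Fintype.card d := by positivity

omit [DecidableEq d] in
/-- `dirichletNorm > 0`. [folklore] -/
theorem dirichletNorm_pos (r : ℕ) : 0 < dirichletNorm d r :=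
  Real.sqrt_pos.mpr (pow_card_pos r)

omit [DecidableEq d] in
/-- `dirichletNorm² = (2r+1)^d`. [folklore] -/
theorem dirichletNorm_sq (r : ℕ) : dirichletNorm d r ^ 2 = (2 * r + 1 : ℝ) ^ Fintype.card d :=
  Real.sq_sqrt (pow_card_pos r).le

/-- **The normalised Dirichlet kernel** `D_r = (2r+1)^{-d/2} ∑_{k ∈ Ω_r} e_k` on `T^d`
(complex-valued; its values are real, `dirichletKernel_im`). On `T³` this is the printed
`D_r(x) = (2r+1)^{-3/2} ∑_{ξ ∈ Ω_r} e^{iξ·x}` transported to the unit torus.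
[cite: LuoTiti2020, §3.2] -/
def dirichletKernel (r : ℕ) : UnitAddTorus d → ℂ :=
  trigPoly (freqCube r) fun _ => (((dirichletNorm d r)⁻¹ : ℝ) : ℂ)

/-- Unfolding: `D_r x = ∑_{k ∈ Ω_r} e_k(x) (2r+1)^{-d/2}`. [folklore] -/
theorem dirichletKernel_apply (r : ℕ) (x : UnitAddTorus d) :
    dirichletKernel r x = ∑ k ∈ freqCube r, mFourier k x * (((dirichletNorm d r)⁻¹ : ℝ) : ℂ) := by
  simp only [dirichletKernel, trigPoly_apply, smul_eq_mul]

/-- `D_r` is smooth (a trigonometric polynomial). [folklore] -/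
theorem isSmooth_dirichletKernel (r : ℕ) : IsSmooth (dirichletKernel (d := d) r) :=
  isSmooth_trigPoly _ _

/-- `D_r` is continuous. [folklore] -/
theorem continuous_dirichletKernel (r : ℕ) : Continuous (dirichletKernel (d := d) r) :=
  continuous_trigPoly _ _

/-- **Fourier coefficients of `D_r`**: `(2r+1)^{-d/2}` on `Ω_r` and `0` off `Ω_r` — in
particular `D_r` is frequency-localised to `|k|_∞ ≤ r` (BV19: "`P_{≤2λσrN_Λ} η = η`" for the
rescaled kernel). [cite: BuckmasterVicol2019AnnMath, §3.2] -/
theorem mFourierCoeff_dirichletKernel (r : ℕ) (k : d → ℤ) :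
    mFourierCoeff (dirichletKernel (d := d) r) k =
      if k ∈ freqCube r then (((dirichletNorm d r)⁻¹ : ℝ) : ℂ) else 0 :=
  mFourierCoeff_trigPoly _ _ k

/-- **`D_r` is real-valued**: `conj (D_r x) = D_r x` (the coefficients are real and
`Ω_r = -Ω_r`). [cite: BuckmasterVicol2019AnnMath, §3.2] -/
theorem conj_dirichletKernel (r : ℕ) (x : UnitAddTorus d) :
    conj (dirichletKernel r x) = dirichletKernel r x := by
  rw [dirichletKernel_apply, map_sum]
  simp_rw [map_mul, ← mFourier_neg, Complex.conj_ofReal]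
  -- reindex the sum along the involution `k ↦ -k` of `Ω_r`
  exact Finset.sum_nbij' (fun k => -k) (fun k => -k) (fun k hk => neg_mem_freqCube hk)
    (fun k hk => neg_mem_freqCube hk) (fun k _ => neg_neg k) (fun k _ => neg_neg k) (fun k _ => rfl)

/-- The imaginary part of `D_r x` vanishes. [folklore] -/
theorem dirichletKernel_im (r : ℕ) (x : UnitAddTorus d) : (dirichletKernel r x).im = 0 := by
  have h := conj_dirichletKernel r x
  exact Complex.conj_eq_iff_im.mp h

/-- `D_r x = Re D_r x` as a complex number. [folklore] -/
theorem ofReal_re_dirichletKernel (r : ℕ) (x : UnitAddTorus d) :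
    ((dirichletKernel r x).re : ℂ) = dirichletKernel r x :=
  Complex.conj_eq_iff_re.mp (conj_dirichletKernel r x)

/-- **The `L²` normalisation `∫_{T^d} |D_r|² = 1`** (finite Parseval: `#Ω_r · (2r+1)^{-d} = 1`);
the printed "`‖D_r‖²_{L²} = (2π)³`" for the unnormalised measure of `[-π,π]³`.
[cite: BuckmasterVicol2019AnnMath, §3.2 (3.7)] -/
theorem integral_norm_sq_dirichletKernel (r : ℕ) : ∫ x, ‖dirichletKernel (d := d) r x‖ ^ 2 = 1 := by
  rw [dirichletKernel, integral_norm_sq_trigPoly, Finset.sum_const, card_freqCube, nsmul_eq_mul,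
    Complex.norm_real, Real.norm_eq_abs, sq_abs, inv_pow, dirichletNorm_sq]
  push_cast
  exact mul_inv_cancel₀ (pow_card_pos r).ne'

omit [DecidableEq d] in
/-- `(2r+1)^d = dirichletNorm²` with the natural-number power cast to `ℝ`. [folklore] -/
theorem cast_pow_card_eq (r : ℕ) :
    (((2 * r + 1) ^ Fintype.card d : ℕ) : ℝ) = dirichletNorm d r * dirichletNorm d r := by
  rw [← sq, dirichletNorm_sq]; push_cast; ring

/-- **Sup bound `|D_r(x)| ≤ (2r+1)^{d/2}`** (triangle inequality: `#Ω_r · (2r+1)^{-d/2}`), the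
case `p = ∞` of the printed `‖D_r‖_{L^p} ≲ r^{3/2-3/p}`. [cite: BuckmasterVicol2019AnnMath, §3.2 (3.7)] -/
theorem norm_dirichletKernel_le (r : ℕ) (x : UnitAddTorus d) :
    ‖dirichletKernel r x‖ ≤ dirichletNorm d r := by
  rw [dirichletKernel_apply]
  refine (norm_sum_le _ _).trans ?_
  have hN := dirichletNorm_pos (d := d) r
  have hterm : ∀ k ∈ freqCube (d := d) r,
      ‖mFourier k x * (((dirichletNorm d r)⁻¹ : ℝ) : ℂ)‖ = (dirichletNorm d r)⁻¹ := by
    intro k _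
    rw [norm_mul, norm_mFourier_apply, one_mul, Complex.norm_real, Real.norm_eq_abs,
      abs_of_pos (inv_pos.mpr hN)]
  rw [Finset.sum_congr rfl hterm, Finset.sum_const, card_freqCube, nsmul_eq_mul, cast_pow_card_eq,
    mul_assoc, mul_inv_cancel₀ hN.ne', mul_one]

/-- The sup bound in the shape `|D_r(x)| ≤ 3^{d/2} r^{d/2}` for `r ≥ 1` (`2r + 1 ≤ 3r`).
[cite: BuckmasterVicol2019AnnMath, §3.2 (3.7)] -/
theorem norm_dirichletKernel_le_rpow {r : ℕ} (hr : 1 ≤ r) (x : UnitAddTorus d) :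
    ‖dirichletKernel r x‖ ≤ (3 * r : ℝ) ^ ((Fintype.card d : ℝ) / 2) := by
  refine (norm_dirichletKernel_le r x).trans ?_
  have hr' : (1 : ℝ) ≤ r := by exact_mod_cast hr
  have h3 : (2 * r + 1 : ℝ) ≤ 3 * r := by linarith
  rw [dirichletNorm, Real.sqrt_eq_rpow, ← Real.rpow_natCast, ← Real.rpow_mul (by positivity)]
  rw [mul_one_div]
  exact Real.rpow_le_rpow (by positivity) h3 (by positivity)

/-! ## The printed `L^p` bound (named fact) -/

/-- **Buckmaster–Vicol 2019, (3.7) / Luo–Titi 2020, §3.2 — the `L^p` bound of the normalised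
Dirichlet kernel, named fact** (not proved here). *Printed (BV19):* "such that for `1 < p ≤ ∞`
we have `‖D_r‖²_{L²} = (2π)³`, and `‖D_r‖_{L^p} ≲ r^{3/2 - 3/p}`, where the implicit constant
depends only on `p`." Rendering: dimension `3` as printed (`T³ = UnitAddTorus (Fin 3)`, probability
Haar measure, for which the `L²` identity is `integral_norm_sq_dirichletKernel`); finite
exponents `1 < p < ∞` (the case `p = ∞` is `norm_dirichletKernel_le`); `r ≥ 1`; the constant
`C` depends on `p` only. Proof in the sources: `D_r` is the tensor product of three
one-dimensional Dirichlet kernels `D_r(t) = ∑_{|j|≤r} e^{2πijt} = sin((2r+1)πt)/sin(πt)` with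
`‖D_r‖_{L^p(T)} ∼ r^{1-1/p}` for `p > 1` (BV19 (3.6), after Grafakos).
[cite: BuckmasterVicol2019AnnMath, §3.2 (3.7)] -/
def dirichletKernel_Lp_bound : Prop :=
  ∀ p : ℝ, 1 < p → ∃ C : ℝ, 0 < C ∧ ∀ r : ℕ, 1 ≤ r →
    eLpNorm (dirichletKernel (d := Fin 3) r) (ENNReal.ofReal p) volume ≤
      ENNReal.ofReal (C * (r : ℝ) ^ (3 / 2 - 3 / p : ℝ))

end Torus

end Literature.Analysis.FunctionSpaces
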